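import Literature.Claims.NS.ClayVariants
import HarnessLib

/-!
# Claim skeleton (D-0090 NS-CLAIMS, C51): L. A. Roman-Miller, «The Exact General Solution of Painlevé's
# Sixth Equation (PVI) and The Exact General Solution of the Navier Stokes Equations …», arXiv:1103.1408 v1
# (28 Feb 2011, math.GM) — multivariate power-series «general solution»

Cell `ns-claims`, row C51 (T3 tail of QUEUE v1.17), typist `ns-claims-typist-12` (lanes: refuter first idle
(PREDICTED-R), ref-1 g2, salvage by family (p1 g2), writer-1, lit-4 stub + lit-1 g5 files). Text of record:
arXiv 1103.1408 **v1** (only version; 17 pp., PDF page = printed page; `pub/ns-claims/sources/RomanMiller2011/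
arXiv-1103.1408v1-PDF/`), bib `RomanMiller2011`. No «Clay»/«Millennium» sentence is printed (lit-1 grep); the
claim typed is the abstract's/§5's «exact general solution of the Navier Stokes equations». UNREFEREED CLAIM
under adjudication — NOTHING in this file asserts a step: every `Step_k`/`ClaimedTheorem` is a `Prop`; the
`theorem`s are kernel compositions of the paper's own implications. Card
`pub/ns-claims/claims/RomanMiller2011/CARD.md` (PREDICTION §4 frozen 2026-08-27T01:03:27Z, sha16 0e4c8b7c170aa643).

## Claimed statement (as printed)

Abstract p. 1 (complete): «This paper provides the first known exact general solutions of Painlevé's sixth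
equation (PVI) and the exact general solutions of the Navier Stokes equations and Prandtl's boundary layer
equations.» §4 p. 8: «This paper presents what is apparently the first set of general and exact solutions of
the Navier Stokes equations». **§5 «The Exact General Solution of the Navier Stokes Equations» pp. 9–11**:
(14) the incompressible NS system for `(u,v,w,P)` with density `ρ`, kinematic viscosity `ν`, no body force,
on unspecified domain/time; (15) continuity; the ansatz p. 10 «For u = Σ_{i,j,k,l≥0} A_{i,j,k,l} xⁱ yʲ zᵏ tˡ …»,
likewise `v ↔ B`, `w ↔ C`, `P ↔ D` (p. 10–11); (16)–(17) the Cauchy-product bookkeeping for `u ∂u/∂x`; p. 11: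
«then the coefficients of the analytic solution of the Navier Stokes equations (14) are defined by the
following equations» **(18)–(20)** (one per momentum component) and **(21)** `0 = (i+1)A_{i+1,j,k,l} +
(j+1)B_{i,j+1,k,l} + (k+1)C_{i,j,k+1,l}` (continuity). Nothing further: no data, no domain, no convergence
statement, no solution of the relations (they are not a recursion — (18)–(21) constrain, they do not determine).

RENDERING: `ρ = 1` (the tree's momentum equation carries `−∇p`; `P/ρ ↦ p`), whole space and all times
(`S = univ`), classical solutions in the tree vocabulary. «Exact general solution … analytic solution whose
coefficients are defined by (18)–(21)» is rendered as: EVERY classical solution is, componentwise, the sum of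
an everywhere-convergent power series in `(x, y, z, t)` whose coefficient families satisfy (18)–(21)
(`ClaimedTheorem`); the two halves are typed separately — `Step_general` (every solution is such a series:
the word «general») and `Step_coeff` (for series solutions the relations (18)–(21) hold: the equating of
coefficients, pp. 10–11).

## Clay delta (reference `Literature.Claims.NS.ClayVariants`, axes Δ1–Δ8)

No Clay statement printed. Δ4/Δ5/Δ6: no data class, formal multivariate series, «general solution» as a
structure claim; nearest (A) only through `Step_bridge` (unproved; wrong-problem carrier).

## Steps — ORDERED INDEX (TYPING-HYGIENE 11; print order)

Step 1 = (14)–(15) p. 9–10 (the system; vocabulary) · **Step 2 = `Step_general`** (p. 10 «For u = Σ A_{ijkl}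
xⁱyʲzᵏtˡ …», p. 11 «the coefficients of the analytic solution», title/abstract «exact GENERAL solution»: every
classical solution is an everywhere-convergent 4-variable power series, componentwise and for the pressure;
typist's flag: suspicious — smooth non-analytic solutions exist (pressure gauge `P = P(t)` flat at `0`; heat
shear flows with non-analytic data)) · **Step 3 = `Step_coeff`** ((16)–(21) pp. 10–11: equating coefficients
— for power-series solutions the families satisfy (18)–(21); typist's flag: plausible (Cauchy product;
identity theorem), not the failing step) · Step 4 = `Step_bridge` (abstract read toward (A)).

## COMPOSITION — proved as `claim_of_steps`

`claim_of_steps : Step_general → Step_coeff → ClaimedTheorem` — PROVED.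

WHAT THIS IS NOT: not a claim about NS regularity or blow-up; not a claim about any author beyond the
typed locator.
-/

noncomputable section

open Set Function Finset
open scoped ContDiff BigOperators
open Literature.Analysis.FluidPDE

namespace Literature.Claims.NS.RomanMiller2011

/-- `ℝ³` with coordinates `x = x 0`, `y = x 1`, `z = x 2`. [cite: RomanMiller2011, (14) p. 9] -/
abbrev E3 := EuclideanSpace ℝ (Fin 3)

/-- A coefficient family `A_{i,j,k,l}`, `i,j,k,l ≥ 0` (p. 10). [cite: RomanMiller2011, §5 p. 10] -/
abbrev Coeff := ℕ → ℕ → ℕ → ℕ → ℝ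

/-- The monomial `xⁱ yʲ zᵏ tˡ` at the point `x` and time `t`. [cite: RomanMiller2011, §5 p. 10] -/
def monomial (x : E3) (t : ℝ) (n : ℕ × ℕ × ℕ × ℕ) : ℝ :=
  x 0 ^ n.1 * x 1 ^ n.2.1 * x 2 ^ n.2.2.1 * t ^ n.2.2.2

/-- «`f = Σ_{i,j,k,l ≥ 0} A_{i,j,k,l} xⁱ yʲ zᵏ tˡ`» at EVERY `(x, t) ∈ ℝ³ × ℝ` (p. 10; the print states no
domain — rendered as everywhere-convergent, summed over `ℕ⁴`). [cite: RomanMiller2011, §5 p. 10] -/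
def IsSeriesOf (A : Coeff) (f : ℝ → E3 → ℝ) : Prop :=
  ∀ (t : ℝ) (x : E3),
    HasSum (fun n : ℕ × ℕ × ℕ × ℕ => A n.1 n.2.1 n.2.2.1 n.2.2.2 * monomial x t n) (f t x)

/-- The left side of (18)/(19)/(20) for the component family `X ∈ {A, B, C}` (p. 11): the resolved
nonlinear members `Σ_{p≤i,q≤j,r≤k,s≤l} [(i−p+1)A_{pqrs}X_{i−p+1,j−q,k−r,l−s} + (j−q+1)B_{pqrs}X_{i−p,j−q+1,k−r,l−s}
+ (k−r+1)C_{pqrs}X_{i−p,j−q,k−r+1,l−s}]` plus the time term `(l+1)X_{i,j,k,l+1}`.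
[cite: RomanMiller2011, (17)–(20) pp. 10–11] -/
def lhs (A B C X : Coeff) (i j k l : ℕ) : ℝ :=
  (∑ p ∈ range (i + 1), ∑ q ∈ range (j + 1), ∑ r ∈ range (k + 1), ∑ s ∈ range (l + 1),
      (((i - p + 1 : ℕ) : ℝ) * A p q r s * X (i - p + 1) (j - q) (k - r) (l - s)
        + ((j - q + 1 : ℕ) : ℝ) * B p q r s * X (i - p) (j - q + 1) (k - r) (l - s)
        + ((k - r + 1 : ℕ) : ℝ) * C p q r s * X (i - p) (j - q) (k - r + 1) (l - s)))
    + ((l + 1 : ℕ) : ℝ) * X i j k (l + 1)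

/-- The viscous right-side member of (18)/(19)/(20) for the family `X`: `ν[(i+2)(i+1)X_{i+2,j,k,l} +
(j+2)(j+1)X_{i,j+2,k,l} + (k+2)(k+1)X_{i,j,k+2,l}]`. [cite: RomanMiller2011, (18)–(20) p. 11] -/
def visc (ν : ℝ) (X : Coeff) (i j k l : ℕ) : ℝ :=
  ν * ((((i + 2) * (i + 1) : ℕ) : ℝ) * X (i + 2) j k l + (((j + 2) * (j + 1) : ℕ) : ℝ) * X i (j + 2) k l
      + (((k + 2) * (k + 1) : ℕ) : ℝ) * X i j (k + 2) l)

/-- **The coefficient relations (18)–(21) p. 11** («the coefficients of the analytic solution of the Navier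
Stokes equations (14) are defined by the following equations»), with density `ρ`.
[cite: RomanMiller2011, (18)–(21) p. 11] -/
def CoeffRelations (ρ ν : ℝ) (A B C D : Coeff) : Prop :=
  (∀ i j k l, lhs A B C A i j k l = -(1 / ρ) * ((i + 1 : ℕ) : ℝ) * D (i + 1) j k l + visc ν A i j k l) ∧
  (∀ i j k l, lhs A B C B i j k l = -(1 / ρ) * ((j + 1 : ℕ) : ℝ) * D i (j + 1) k l + visc ν B i j k l) ∧
  (∀ i j k l, lhs A B C C i j k l = -(1 / ρ) * ((k + 1 : ℕ) : ℝ) * D i j (k + 1) l + visc ν C i j k l) ∧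
  (∀ i j k l, (0 : ℝ) = ((i + 1 : ℕ) : ℝ) * A (i + 1) j k l + ((j + 1 : ℕ) : ℝ) * B i (j + 1) k l
      + ((k + 1 : ℕ) : ℝ) * C i j (k + 1) l)

/-- A classical solution `(u, p)` (tree vocabulary, `ρ = 1`, no force, all of space-time) together with
four coefficient families summing to its components and pressure everywhere («analytic solution», p. 11).
[cite: RomanMiller2011, §5 pp. 10–11] -/
def IsSeriesSolution (ν : ℝ) (u : ℝ → E3 → E3) (p : ℝ → E3 → ℝ) (A B C D : Coeff) : Prop :=
  IsClassicalNSSolutionOn univ ν 0 u p ∧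
    IsSeriesOf A (fun t x => u t x 0) ∧ IsSeriesOf B (fun t x => u t x 1) ∧
    IsSeriesOf C (fun t x => u t x 2) ∧ IsSeriesOf D p

/-! ### The claimed statement -/

/-- **«The exact general solution of the Navier Stokes equations» (title, abstract p. 1, §5 pp. 9–11),
rendered**: for every `ν > 0`, every classical solution `(u, p)` of (14)–(15) on all of space-time (`ρ = 1`,
no force) is the sum of everywhere-convergent power series in `(x,y,z,t)` — components `A, B, C`, pressure
`D` — whose coefficients satisfy (18)–(21). Typist's flag: suspicious. [cite: RomanMiller2011, abstract
p. 1; §5 pp. 9–11, (18)–(21)] -/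
def ClaimedTheorem : Prop :=
  ∀ ν : ℝ, 0 < ν → ∀ (u : ℝ → E3 → E3) (p : ℝ → E3 → ℝ), IsClassicalNSSolutionOn univ ν 0 u p →
    ∃ A B C D : Coeff, IsSeriesSolution ν u p A B C D ∧ CoeffRelations 1 ν A B C D

/-! ### The steps -/

/-- **Step 2 — «general» / «the analytic solution» (p. 10 ansatz «For u = Σ A_{i,j,k,l} xⁱyʲzᵏtˡ …», p. 11;
title)**: every classical solution on all of space-time is, componentwise and for the pressure, the sum of
an everywhere-convergent 4-variable power series. Typist's flag: suspicious (non-analytic smooth solutions: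
`u ≡ 0`, `p(t) = expNegInvGlue t`; heat shear flows from non-analytic data).
[cite: RomanMiller2011, §5 p. 10–11; abstract p. 1] -/
def Step_general : Prop :=
  ∀ ν : ℝ, 0 < ν → ∀ (u : ℝ → E3 → E3) (p : ℝ → E3 → ℝ), IsClassicalNSSolutionOn univ ν 0 u p →
    ∃ A B C D : Coeff, IsSeriesSolution ν u p A B C D

/-- **Step 3 — equating coefficients, (16)–(21) pp. 10–11**: if a classical solution is the sum of such
series then the coefficient families satisfy (18)–(21) («after resolving each nonlinear member … so as to
permit equating of coefficients of xⁱyʲzᵏtˡ»). Typist's flag: plausible (Cauchy products of absolutely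
convergent multivariate series; uniqueness of coefficients) — not the failing step; left unproved.
[cite: RomanMiller2011, (16)–(21) pp. 10–11] -/
def Step_coeff : Prop :=
  ∀ ν : ℝ, 0 < ν → ∀ (u : ℝ → E3 → E3) (p : ℝ → E3 → ℝ) (A B C D : Coeff),
    IsSeriesSolution ν u p A B C D → CoeffRelations 1 ν A B C D

/-- **Step 4 — the abstract read toward Clay (A)** («the exact general solutions of the Navier Stokes
equations»): no Clay sentence is printed; TYPED as the bridge, which carries Δ4/Δ5/Δ6 (no data, formal
series, no existence). Typist's flag: suspicious. [cite: RomanMiller2011, abstract p. 1; §7 p. 16] -/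
def Step_bridge : Prop :=
  ClaimedTheorem → ClayVariants.clayR3.Regularity

/-! ### Kernel relations -/

/-- **KERNEL COMPOSITION** — the claimed sentence from «general» and the equating of coefficients.
[cite: RomanMiller2011, §5 pp. 9–11] -/
theorem claim_of_steps (hgen : Step_general) (hco : Step_coeff) : ClaimedTheorem := by
  intro ν hν u p hsol
  obtain ⟨A, B, C, D, hser⟩ := hgen ν hν u p hsol
  exact ⟨A, B, C, D, hser, hco ν hν u p A B C D hser⟩

/-- The claim contains Step 2 (projection). [cite: RomanMiller2011, §5 p. 10] -/
theorem step_general_of_claim (h : ClaimedTheorem) : Step_general := by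
  intro ν hν u p hsol
  obtain ⟨A, B, C, D, hser, -⟩ := h ν hν u p hsol
  exact ⟨A, B, C, D, hser⟩

/-- Clay (A) from the claim and the bridge (modus ponens; MAP's Clay column).
[cite: RomanMiller2011, abstract p. 1] -/
theorem clay_of_claimed_and_bridge (hC : ClaimedTheorem) (hbr : Step_bridge) :
    ClayVariants.clayR3.Regularity :=
  hbr hC

end Literature.Claims.NS.RomanMiller2011

end
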